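import Summits.AtomisticToContinuum.Crystallization.Theorems.SquareWellLayerCakeGapTwelveToBarlowNoSixCommonNeighbours

/-!
# Combinatorial layering (B1a of `GapTwelveToBarlow`): the five-point lens lemma `(H_lens)`

Crux `SquareWellLayerCake.GapTwelveToBarlow` (stmt-AtomisticToContinuum-15807), line `Sketch`,
stub `stub_combinatorialLayering`.  The chart transfer lemma (`…CombinatorialLayeringTransfer`)
was proved modulo ONE closed statement of metric geometry, discharged here:

`(H_lens)` — for a bonded pair `x ~ y` (`|xy| ∈ [55/57, 1]`) and three common neighbours
`a, b, c` (all six distances to `x, y` in `[55/57, 1]`) with `a ~ b` (`|ab| ∈ [55/57, 1]`), the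
cross distances `|ac|`, `|bc|` cannot both lie in `[131/100, √(4 − (131/100)²)]`.

## Proof (the lens picture of `…NoSixCommonNeighbours`, whose algebraic lemmas are reused)

With `d = |xy|`, unit axis `u = (y − x)/d`, axial coordinates `s_p = ⟪p − x, u⟫` and transversal
parts `P_p = p − x − s_p u ⊥ u` (`p = a, b, c`): `|p − x|² = |P_p|² + s_p²`,
`|p − y|² = |P_p|² + (s_p − d)²`, whence `ρ_p² = |P_p|² ∈ [0.6797, 0.7673]` (`rho_window`:
`ρ² = (A + B)/2 − d²/4 − (s − d/2)²` with `(s − d/2)² ≤ ((1 − λ²)/(2λ))²`), and for two of them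
`|p − q|² = |P_p − P_q|² + (s_p − s_q)²` with `(s_p − s_q)² ≤ 3/500` (`axial_diff_sq_le`).  So
the planar inner products `⟪P_p, P_q⟫ = (ρ_p² + ρ_q² − |P_p − P_q|²)/2` give, for the unit
transversal directions, `cos θ_ab ∈ [0.263, 2/5]` (`|ab|² ∈ [λ², 1]`) and
`cos θ_ac, cos θ_bc ∈ [−0.681, −1/9]` (`|pc|² ∈ [1.31², 4 − 1.31²]`) (`cos_bounds_near`,
`cos_bounds_far`).  The directions live in the plane `u^⊥ ≃ ℂ`; for three unit vectors of a
plane `cos θ_bc = cos θ_ab cos θ_ac ± sin θ_ab sin θ_ac` with `sin θ_ab sin θ_ac ≥ 0.669`, and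
both signs are excluded: `+` gives `cos θ_bc ≥ 0.39 > −1/9`, `−` gives
`cos θ_bc ≤ −0.698 < −0.681` (`planar_three_unit`).  Anchor: `lens_five_points`, the statement
`(H_lens)` verbatim.  Mathlib + the algebraic lemmas of `…NoSixCommonNeighbours`; nothing is
defined, no named fact is used.
-/

noncomputable section

namespace Summit.AtomisticToContinuum.Crystallization.Theorems.SquareWellLayerCakeGapTwelveToBarlow

open scoped InnerProductSpace ComplexConjugate Real

/-! ## Scalar lemmas -/

/-- Transversal radius window of a common neighbour: if `A = ρ² + s²` and `B = ρ² + (s − d)²`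
lie in `[(55/57)², 1]` and `d ∈ [55/57, 1]`, then `0.6797 ≤ ρ² ≤ 0.7673`. [folklore] -/
theorem rho_window {d A B ρ2 s : ℝ} (hd1 : 55 / 57 ≤ d) (hd2 : d ≤ 1)
    (hA1 : (55 / 57 : ℝ) ^ 2 ≤ A) (hA2 : A ≤ 1) (hB1 : (55 / 57 : ℝ) ^ 2 ≤ B) (hB2 : B ≤ 1)
    (hA : A = ρ2 + s ^ 2) (hB : B = ρ2 + (s - d) ^ 2) :
    (6797 : ℝ) / 10000 ≤ ρ2 ∧ ρ2 ≤ 7673 / 10000 := by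
  have hsd : 2 * s * d = A - B + d ^ 2 := by rw [hA, hB]; ring
  have hρ : ρ2 = (A + B) / 2 - d ^ 2 / 4 - (s - d / 2) ^ 2 := by rw [hA, hB]; ring
  have hdpos : 0 < d := by linarith
  have hd2sq : (55 / 57 : ℝ) ^ 2 ≤ d ^ 2 := pow_le_pow_left₀ (by norm_num) hd1 2
  constructor
  · -- `(s - d/2)² · 4d² = (A - B)² ≤ (1 - λ²)²`, `4 d² ≥ 4 λ²`
    have hX : (s - d / 2) ^ 2 * (4 * d ^ 2) = (A - B) ^ 2 := by
      have : (s - d / 2) * (2 * d) = A - B := by linarith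
      nlinarith [this]
    have hAB : (A - B) ^ 2 ≤ (1 - (55 / 57 : ℝ) ^ 2) ^ 2 := by
      have h1 : A - B ≤ 1 - (55 / 57 : ℝ) ^ 2 := by linarith
      have h2 : -(1 - (55 / 57 : ℝ) ^ 2) ≤ A - B := by linarith
      exact sq_le_sq' h2 h1
    have hE : (s - d / 2) ^ 2 ≤ 12544 / 9828225 := by
      nlinarith [mul_le_mul_of_nonneg_left hd2sq (sq_nonneg (s - d / 2))]
    rw [hρ]
    norm_num at hA1 hB1 hd2sq ⊢
    nlinarith
  · rw [hρ]
    nlinarith [sq_nonneg (s - d / 2)]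

/-- Product of two radii: `ρ_p ρ_q ∈ [0.6797, 0.7673]`. [folklore] -/
theorem rho_mul_window {ρp ρq : ℝ} (hp0 : 0 ≤ ρp) (hq0 : 0 ≤ ρq)
    (hp1 : (6797 : ℝ) / 10000 ≤ ρp ^ 2) (hp2 : ρp ^ 2 ≤ 7673 / 10000)
    (hq1 : (6797 : ℝ) / 10000 ≤ ρq ^ 2) (hq2 : ρq ^ 2 ≤ 7673 / 10000) :
    (6797 : ℝ) / 10000 ≤ ρp * ρq ∧ ρp * ρq ≤ 7673 / 10000 := by
  have hpq := mul_nonneg hp0 hq0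
  constructor
  · by_contra! h
    have h2 : (ρp * ρq) ^ 2 < ((6797 : ℝ) / 10000) ^ 2 := by
      exact pow_lt_pow_left₀ h hpq two_ne_zero
    nlinarith [mul_le_mul hp1 hq1 (by norm_num) (sq_nonneg ρp)]
  · nlinarith [sq_nonneg (ρp - ρq)]

/-- Cosine window of the bonded pair: with `T = |P_a − P_b|² ∈ [λ² − 3/500, 1]` the planar
inner product `ip = (ρ_a² + ρ_b² − T)/2` satisfies `0.263 ρ_a ρ_b ≤ ip ≤ (2/5) ρ_a ρ_b`.
[folklore] -/
theorem cos_bounds_near {ρp ρq ip T : ℝ} (hp0 : 0 ≤ ρp) (hq0 : 0 ≤ ρq)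
    (hp1 : (6797 : ℝ) / 10000 ≤ ρp ^ 2) (hp2 : ρp ^ 2 ≤ 7673 / 10000)
    (hq1 : (6797 : ℝ) / 10000 ≤ ρq ^ 2) (hq2 : ρq ^ 2 ≤ 7673 / 10000)
    (hT1 : (55 / 57 : ℝ) ^ 2 - 3 / 500 ≤ T) (hT2 : T ≤ 1)
    (hip : T = ρp ^ 2 - 2 * ip + ρq ^ 2) :
    (263 : ℝ) / 1000 * (ρp * ρq) ≤ ip ∧ ip ≤ 2 / 5 * (ρp * ρq) := by
  obtain ⟨hm1, hm2⟩ := rho_mul_window hp0 hq0 hp1 hp2 hq1 hq2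
  constructor
  · nlinarith [sq_nonneg (ρp - ρq)]
  · norm_num at hT1
    nlinarith [sq_nonneg (ρp - ρq)]

/-- Cosine window of a far pair: with `T = |P_p − P_c|² ∈ [1.31² − 3/500, 4 − 1.31²]` the
planar inner product satisfies `−0.681 ρ_p ρ_c ≤ ip ≤ −(1/9) ρ_p ρ_c`. [folklore] -/
theorem cos_bounds_far {ρp ρq ip T : ℝ} (hp0 : 0 ≤ ρp) (hq0 : 0 ≤ ρq)
    (hp1 : (6797 : ℝ) / 10000 ≤ ρp ^ 2) (hp2 : ρp ^ 2 ≤ 7673 / 10000)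
    (hq1 : (6797 : ℝ) / 10000 ≤ ρq ^ 2) (hq2 : ρq ^ 2 ≤ 7673 / 10000)
    (hT1 : (131 / 100 : ℝ) ^ 2 - 3 / 500 ≤ T) (hT2 : T ≤ 4 - (131 / 100 : ℝ) ^ 2)
    (hip : T = ρp ^ 2 - 2 * ip + ρq ^ 2) :
    -((681 : ℝ) / 1000) * (ρp * ρq) ≤ ip ∧ ip ≤ -(1 / 9) * (ρp * ρq) := by
  obtain ⟨hm1, hm2⟩ := rho_mul_window hp0 hq0 hp1 hp2 hq1 hq2
  norm_num at hT1 hT2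
  constructor
  · nlinarith [sq_nonneg (ρp - ρq)]
  · nlinarith [sq_nonneg (ρp - ρq)]

/-- **Three unit vectors of a plane cannot have these cosines**: `cos θ_ab ∈ [0.263, 2/5]`,
`cos θ_ac, cos θ_bc ∈ [−0.681, −1/9]`.  In coordinates `cos θ_bc = cos θ_ab cos θ_ac + δ_ab δ_ac`
with `δ_pq` the `2 × 2` determinants, `δ_ab² = 1 − cos² θ_ab ≥ 0.84`,
`δ_ac² = 1 − cos² θ_ac ≥ 1 − 0.681²`, so `|δ_ab δ_ac| ≥ 0.669`; the sign `+` forces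
`cos θ_bc ≥ −0.2724 + 0.669 > −1/9`, the sign `−` forces `cos θ_bc ≤ −0.0292 − 0.669 < −0.681`.
[folklore] -/
theorem planar_three_unit {ar ai br bi cr ci : ℝ} (ha : ar * ar + ai * ai = 1)
    (hb : br * br + bi * bi = 1) (hc : cr * cr + ci * ci = 1)
    (hab1 : (263 : ℝ) / 1000 ≤ ar * br + ai * bi) (hab2 : ar * br + ai * bi ≤ 2 / 5)
    (hac1 : -((681 : ℝ) / 1000) ≤ ar * cr + ai * ci) (hac2 : ar * cr + ai * ci ≤ -(1 / 9))
    (hbc1 : -((681 : ℝ) / 1000) ≤ br * cr + bi * ci) (hbc2 : br * cr + bi * ci ≤ -(1 / 9)) :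
    False := by
  -- the planar identity and the Lagrange identities
  have key : br * cr + bi * ci =
      (ar * br + ai * bi) * (ar * cr + ai * ci) + (ar * bi - ai * br) * (ar * ci - ai * cr) := by
    linear_combination (-(br * cr + bi * ci)) * ha
  have lab : (ar * bi - ai * br) ^ 2 = 1 - (ar * br + ai * bi) ^ 2 := by
    linear_combination (br * br + bi * bi) * ha + hb
  have lac : (ar * ci - ai * cr) ^ 2 = 1 - (ar * cr + ai * ci) ^ 2 := by
    linear_combination (cr * cr + ci * ci) * ha + hc
  -- abstract the three cosines and the product of determinants
  obtain ⟨p, hp⟩ : ∃ p : ℝ, p = ar * br + ai * bi := ⟨_, rfl⟩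
  obtain ⟨q, hq⟩ : ∃ q : ℝ, q = ar * cr + ai * ci := ⟨_, rfl⟩
  obtain ⟨X, hX⟩ : ∃ X : ℝ, X = (ar * bi - ai * br) * (ar * ci - ai * cr) := ⟨_, rfl⟩
  have hX2e : X ^ 2 = (1 - p ^ 2) * (1 - q ^ 2) := by rw [hX, mul_pow, lab, lac, hp, hq]
  rw [← hp, ← hq, ← hX] at key
  rw [← hp] at hab1 hab2
  rw [← hq] at hac1 hac2
  -- `X² ≥ 0.669²`
  have h1 : (84 : ℝ) / 100 ≤ 1 - p ^ 2 := by
    nlinarith [mul_nonneg (show (0 : ℝ) ≤ 2 / 5 - p by linarith)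
      (show (0 : ℝ) ≤ 2 / 5 + p by linarith)]
  have h2 : 1 - ((681 : ℝ) / 1000) ^ 2 ≤ 1 - q ^ 2 := by
    nlinarith [mul_nonneg (show (0 : ℝ) ≤ 681 / 1000 + q by linarith)
      (show (0 : ℝ) ≤ 681 / 1000 - q by linarith)]
  have hX2 : ((669 : ℝ) / 1000) ^ 2 ≤ X ^ 2 := by
    rw [hX2e]
    have := mul_le_mul h1 h2 (by norm_num) (by linarith)
    norm_num at this ⊢
    linarith
  -- `p q ∈ [2/5 · (−0.681), 0.263 · (−1/9)]`
  have hpq1 : p * q ≤ (263 : ℝ) / 1000 * (-(1 / 9)) := by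
    have e1 : p * q ≤ 263 / 1000 * q := mul_le_mul_of_nonpos_right hab1 (by linarith)
    have e2 : (263 : ℝ) / 1000 * q ≤ 263 / 1000 * (-(1 / 9)) :=
      mul_le_mul_of_nonneg_left hac2 (by norm_num)
    linarith
  have hpq2 : (2 : ℝ) / 5 * (-((681 : ℝ) / 1000)) ≤ p * q := by
    have e1 : 2 / 5 * q ≤ p * q := mul_le_mul_of_nonpos_right hab2 (by linarith)
    have e2 : (2 : ℝ) / 5 * (-((681 : ℝ) / 1000)) ≤ 2 / 5 * q :=
      mul_le_mul_of_nonneg_left hac1 (by norm_num)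
    linarith
  rcases le_or_gt 0 X with h0 | h0
  · have hXge : (669 : ℝ) / 1000 ≤ X := (pow_le_pow_iff_left₀ (by norm_num) h0 two_ne_zero).1 hX2
    linarith
  · have hX2' : ((669 : ℝ) / 1000) ^ 2 ≤ (-X) ^ 2 := by rwa [neg_sq]
    have hXle : (669 : ℝ) / 1000 ≤ -X :=
      (pow_le_pow_iff_left₀ (by norm_num) (by linarith) two_ne_zero).1 hX2'
    linarith

/-! ## The lens lemma -/

/-- **The five-point lens lemma `(H_lens)`** (anchor of this file; the statement is the typed
hypothesis of `…CombinatorialLayeringTransfer`, verbatim): for a bonded pair `x ~ y` and three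
common neighbours `a, b, c` (all nine distances in `[55/57, 1]`) with `a ~ b`, the cross
distances `|ac|`, `|bc|` cannot both lie in `[131/100, √(4 − (131/100)²)]`. [folklore] -/
theorem lens_five_points :
    ∀ x y a b c : EuclideanSpace ℝ (Fin 3), (55 : ℝ) / 57 ≤ dist x y → dist x y ≤ 1 →
      (55 : ℝ) / 57 ≤ dist x a → dist x a ≤ 1 → (55 : ℝ) / 57 ≤ dist x b → dist x b ≤ 1 →
      (55 : ℝ) / 57 ≤ dist x c → dist x c ≤ 1 → (55 : ℝ) / 57 ≤ dist y a → dist y a ≤ 1 →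
      (55 : ℝ) / 57 ≤ dist y b → dist y b ≤ 1 → (55 : ℝ) / 57 ≤ dist y c → dist y c ≤ 1 →
      (55 : ℝ) / 57 ≤ dist a b → dist a b ≤ 1 → (131 : ℝ) / 100 ≤ dist a c →
      dist a c ^ 2 + ((131 : ℝ) / 100) ^ 2 ≤ 4 → (131 : ℝ) / 100 ≤ dist b c →
      dist b c ^ 2 + ((131 : ℝ) / 100) ^ 2 ≤ 4 → False := by
  intro x y a b c hxy1 hxy2 hxa1 hxa2 hxb1 hxb2 hxc1 hxc2 hya1 hya2 hyb1 hyb2 hyc1 hyc2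
    hab1 hab2 hac1 hac2 hbc1 hbc2
  -- the bond length `d` and the unit axis `u`
  obtain ⟨d, hd⟩ : ∃ d : ℝ, d = dist x y := ⟨_, rfl⟩
  rw [← hd] at hxy1 hxy2
  have hdpos : 0 < d := lt_of_lt_of_le (by norm_num) hxy1
  have hnorm_yx : ‖y - x‖ = d := by rw [hd, dist_eq_norm, norm_sub_rev]
  obtain ⟨u, hu⟩ : ∃ u : EuclideanSpace ℝ (Fin 3), u = d⁻¹ • (y - x) := ⟨_, rfl⟩
  have hu1 : ‖u‖ = 1 := by
    rw [hu, norm_smul, norm_inv, Real.norm_eq_abs, abs_of_pos hdpos, hnorm_yx,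
      inv_mul_cancel₀ hdpos.ne']
  have huu : ⟪u, u⟫_ℝ = 1 := by rw [real_inner_self_eq_norm_sq, hu1, one_pow]
  have hyx : y - x = d • u := by rw [hu, smul_smul, mul_inv_cancel₀ hdpos.ne', one_smul]
  -- axial coordinates `s` and transversal parts `P`
  obtain ⟨s, hs⟩ : ∃ s : EuclideanSpace ℝ (Fin 3) → ℝ, ∀ p, s p = ⟪p - x, u⟫_ℝ :=
    ⟨_, fun _ => rfl⟩
  obtain ⟨P, hP⟩ : ∃ P : EuclideanSpace ℝ (Fin 3) → EuclideanSpace ℝ (Fin 3),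
      ∀ p, P p = p - x - s p • u := ⟨_, fun _ => rfl⟩
  have hPu : ∀ p, ⟪P p, u⟫_ℝ = 0 := by
    intro p
    rw [hP, inner_sub_left, real_inner_smul_left, huu, ← hs p]
    ring
  have hpx : ∀ p, p - x = P p + s p • u := by
    intro p
    rw [hP, sub_add_cancel]
  have hpy : ∀ p, p - y = P p + (s p - d) • u := by
    intro p
    rw [hP, sub_smul, ← hyx]
    abel
  have hpq : ∀ p q, p - q = (P p - P q) + (s p - s q) • u := by
    intro p q
    rw [hP, hP, sub_smul]
    abel
  have hA : ∀ p, ‖p - x‖ ^ 2 = ‖P p‖ ^ 2 + s p ^ 2 := by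
    intro p
    rw [hpx]
    exact norm_add_smul_sq_of_inner_eq_zero hu1 (hPu p) _
  have hB : ∀ p, ‖p - y‖ ^ 2 = ‖P p‖ ^ 2 + (s p - d) ^ 2 := by
    intro p
    rw [hpy]
    exact norm_add_smul_sq_of_inner_eq_zero hu1 (hPu p) _
  have hD : ∀ p q, ‖p - q‖ ^ 2 = ‖P p - P q‖ ^ 2 + (s p - s q) ^ 2 := by
    intro p q
    rw [hpq]
    exact norm_add_smul_sq_of_inner_eq_zero hu1 (by rw [inner_sub_left, hPu, hPu, sub_zero]) _
  -- distance windows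
  have hsq : ∀ r : ℝ, 55 / 57 ≤ r → r ≤ 1 → (55 / 57 : ℝ) ^ 2 ≤ r ^ 2 ∧ r ^ 2 ≤ 1 :=
    fun r h1 h2 => ⟨pow_le_pow_left₀ (by norm_num) h1 2, pow_le_one₀ (by linarith) h2⟩
  have hAw : ∀ p, 55 / 57 ≤ dist x p → dist x p ≤ 1 →
      (55 / 57 : ℝ) ^ 2 ≤ ‖p - x‖ ^ 2 ∧ ‖p - x‖ ^ 2 ≤ 1 := by
    intro p h1 h2
    rw [← dist_eq_norm, dist_comm]
    exact hsq _ h1 h2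
  have hBw : ∀ p, 55 / 57 ≤ dist y p → dist y p ≤ 1 →
      (55 / 57 : ℝ) ^ 2 ≤ ‖p - y‖ ^ 2 ∧ ‖p - y‖ ^ 2 ≤ 1 := by
    intro p h1 h2
    rw [← dist_eq_norm, dist_comm]
    exact hsq _ h1 h2
  -- radii
  have hρ : ∀ p, 55 / 57 ≤ dist x p → dist x p ≤ 1 → 55 / 57 ≤ dist y p → dist y p ≤ 1 →
      (6797 : ℝ) / 10000 ≤ ‖P p‖ ^ 2 ∧ ‖P p‖ ^ 2 ≤ 7673 / 10000 :=
    fun p h1 h2 h3 h4 => rho_window hxy1 hxy2 (hAw p h1 h2).1 (hAw p h1 h2).2 (hBw p h3 h4).1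
      (hBw p h3 h4).2 (hA p) (hB p)
  obtain ⟨ρa1, ρa2⟩ := hρ a hxa1 hxa2 hya1 hya2
  obtain ⟨ρb1, ρb2⟩ := hρ b hxb1 hxb2 hyb1 hyb2
  obtain ⟨ρc1, ρc2⟩ := hρ c hxc1 hxc2 hyc1 hyc2
  -- axial differences
  have hΔ : ∀ p q, 55 / 57 ≤ dist x p → dist x p ≤ 1 → 55 / 57 ≤ dist y p → dist y p ≤ 1 →
      55 / 57 ≤ dist x q → dist x q ≤ 1 → 55 / 57 ≤ dist y q → dist y q ≤ 1 →
      (s p - s q) ^ 2 ≤ 3 / 500 :=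
    fun p q h1 h2 h3 h4 h5 h6 h7 h8 =>
      axial_diff_sq_le hxy1 (hAw p h1 h2).1 (hAw p h1 h2).2 (hBw p h3 h4).1 (hBw p h3 h4).2
        (hAw q h5 h6).1 (hAw q h5 h6).2 (hBw q h7 h8).1 (hBw q h7 h8).2 (hA p) (hB p) (hA q) (hB q)
  have hΔab := hΔ a b hxa1 hxa2 hya1 hya2 hxb1 hxb2 hyb1 hyb2
  have hΔac := hΔ a c hxa1 hxa2 hya1 hya2 hxc1 hxc2 hyc1 hyc2
  have hΔbc := hΔ b c hxb1 hxb2 hyb1 hyb2 hxc1 hxc2 hyc1 hyc2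
  -- planar squared distances
  have hTab : (55 / 57 : ℝ) ^ 2 - 3 / 500 ≤ ‖P a - P b‖ ^ 2 ∧ ‖P a - P b‖ ^ 2 ≤ 1 := by
    have h := hD a b
    obtain ⟨h1, h2⟩ := hsq _ hab1 hab2
    rw [dist_eq_norm] at h1 h2
    constructor <;> linarith only [h, h1, h2, hΔab, sq_nonneg (s a - s b)]
  have hTac : (131 / 100 : ℝ) ^ 2 - 3 / 500 ≤ ‖P a - P c‖ ^ 2 ∧
      ‖P a - P c‖ ^ 2 ≤ 4 - (131 / 100 : ℝ) ^ 2 := by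
    have h := hD a c
    have h1 : (131 / 100 : ℝ) ^ 2 ≤ dist a c ^ 2 := pow_le_pow_left₀ (by norm_num) hac1 2
    rw [dist_eq_norm] at h1 hac2
    constructor <;> linarith only [h, h1, hac2, hΔac, sq_nonneg (s a - s c)]
  have hTbc : (131 / 100 : ℝ) ^ 2 - 3 / 500 ≤ ‖P b - P c‖ ^ 2 ∧
      ‖P b - P c‖ ^ 2 ≤ 4 - (131 / 100 : ℝ) ^ 2 := by
    have h := hD b c
    have h1 : (131 / 100 : ℝ) ^ 2 ≤ dist b c ^ 2 := pow_le_pow_left₀ (by norm_num) hbc1 2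
    rw [dist_eq_norm] at h1 hbc2
    constructor <;> linarith only [h, h1, hbc2, hΔbc, sq_nonneg (s b - s c)]
  -- planar inner products
  obtain ⟨cab1, cab2⟩ := cos_bounds_near (norm_nonneg (P a)) (norm_nonneg (P b)) ρa1 ρa2 ρb1 ρb2
    hTab.1 hTab.2 (norm_sub_sq_real (P a) (P b))
  obtain ⟨cac1, cac2⟩ := cos_bounds_far (norm_nonneg (P a)) (norm_nonneg (P c)) ρa1 ρa2 ρc1 ρc2
    hTac.1 hTac.2 (norm_sub_sq_real (P a) (P c))
  obtain ⟨cbc1, cbc2⟩ := cos_bounds_far (norm_nonneg (P b)) (norm_nonneg (P c)) ρb1 ρb2 ρc1 ρc2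
    hTbc.1 hTbc.2 (norm_sub_sq_real (P b) (P c))
  -- unit transversal directions
  have hP0 : ∀ p, (6797 : ℝ) / 10000 ≤ ‖P p‖ ^ 2 → P p ≠ 0 := by
    intro p hp h0
    rw [h0, norm_zero] at hp
    norm_num at hp
  have hPa := hP0 a ρa1
  have hPb := hP0 b ρb1
  have hPc := hP0 c ρc1
  have hunit : ∀ p, P p ≠ 0 → ‖‖P p‖⁻¹ • P p‖ = 1 := fun p hp => norm_smul_inv_norm hp
  have hcos : ∀ p q, P p ≠ 0 → P q ≠ 0 → ∀ lo hi : ℝ, lo * (‖P p‖ * ‖P q‖) ≤ ⟪P p, P q⟫_ℝ →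
      ⟪P p, P q⟫_ℝ ≤ hi * (‖P p‖ * ‖P q‖) →
      lo ≤ ⟪‖P p‖⁻¹ • P p, ‖P q‖⁻¹ • P q⟫_ℝ ∧ ⟪‖P p‖⁻¹ • P p, ‖P q‖⁻¹ • P q⟫_ℝ ≤ hi := by
    intro p q hp hq lo hi h1 h2
    have hp0 : 0 < ‖P p‖ := norm_pos_iff.mpr hp
    have hq0 : 0 < ‖P q‖ := norm_pos_iff.mpr hq
    have hpq : 0 < ‖P p‖ * ‖P q‖ := mul_pos hp0 hq0
    rw [real_inner_smul_left, real_inner_smul_right, ← mul_assoc, ← mul_inv, ← div_eq_inv_mul,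
      le_div_iff₀ hpq, div_le_iff₀ hpq]
    exact ⟨h1, h2⟩
  obtain ⟨vab1, vab2⟩ := hcos a b hPa hPb _ _ cab1 cab2
  obtain ⟨vac1, vac2⟩ := hcos a c hPa hPc _ _ cac1 cac2
  obtain ⟨vbc1, vbc2⟩ := hcos b c hPb hPc _ _ cbc1 cbc2
  -- the plane `u^⊥` is isometric to `ℂ`
  have hu0 : u ≠ 0 := fun h => by
    rw [h, norm_zero] at hu1
    exact zero_ne_one hu1
  haveI : Fact (Module.finrank ℝ (EuclideanSpace ℝ (Fin 3)) = 2 + 1) :=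
    ⟨by rw [finrank_euclideanSpace_fin]⟩
  let Φ : (ℝ ∙ u)ᗮ ≃ₗᵢ[ℝ] ℂ :=
    (Complex.isometryOfOrthonormal (OrthonormalBasis.fromOrthogonalSpanSingleton 2 hu0)).symm
  have hmemK : ∀ p, ‖P p‖⁻¹ • P p ∈ (ℝ ∙ u)ᗮ := fun p =>
    Submodule.mem_orthogonal_singleton_iff_inner_left.mpr
      (by rw [real_inner_smul_left, hPu p, mul_zero])
  obtain ⟨z, hz⟩ : ∃ z : EuclideanSpace ℝ (Fin 3) → ℂ, ∀ p, z p = Φ ⟨‖P p‖⁻¹ • P p, hmemK p⟩ :=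
    ⟨_, fun _ => rfl⟩
  -- coordinates: unit complex numbers with the same pairwise inner products
  have hzunit : ∀ p, P p ≠ 0 → (z p).re * (z p).re + (z p).im * (z p).im = 1 := by
    intro p hp
    have h1 : ‖z p‖ = 1 := by
      rw [hz, LinearIsometryEquiv.norm_map, Submodule.coe_norm, Submodule.coe_mk]
      exact hunit p hp
    rw [← Complex.normSq_apply, Complex.normSq_eq_norm_sq, h1, one_pow]
  have hzip : ∀ p q, P p ≠ 0 → P q ≠ 0 →
      (z p).re * (z q).re + (z p).im * (z q).im = ⟪‖P p‖⁻¹ • P p, ‖P q‖⁻¹ • P q⟫_ℝ := by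
    intro p q hp hq
    have hn : ‖z p - z q‖ = ‖‖P p‖⁻¹ • P p - ‖P q‖⁻¹ • P q‖ := by
      rw [hz, hz, ← map_sub, LinearIsometryEquiv.norm_map, Submodule.coe_norm, Submodule.coe_sub,
        Submodule.coe_mk, Submodule.coe_mk]
    have h1 : ‖z p - z q‖ ^ 2 = ((z p).re - (z q).re) ^ 2 + ((z p).im - (z q).im) ^ 2 := by
      rw [Complex.sq_norm, Complex.normSq_apply, Complex.sub_re, Complex.sub_im]
      ring
    have h2 := norm_sub_sq_real (‖P p‖⁻¹ • P p) (‖P q‖⁻¹ • P q)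
    rw [hunit p hp, hunit q hq] at h2
    rw [hn] at h1
    have h3 : ((z p).re - (z q).re) ^ 2 + ((z p).im - (z q).im) ^ 2 =
        2 - 2 * ((z p).re * (z q).re + (z p).im * (z q).im) := by
      linear_combination hzunit p hp + hzunit q hq
    linear_combination (1 / 2 : ℝ) * h3 + (1 / 2 : ℝ) * h1 - (1 / 2 : ℝ) * h2
  have iab := hzip a b hPa hPb
  have iac := hzip a c hPa hPc
  have ibc := hzip b c hPb hPc
  exact planar_three_unit (hzunit a hPa) (hzunit b hPb) (hzunit c hPc)
    (by linarith only [iab, vab1]) (by linarith only [iab, vab2]) (by linarith only [iac, vac1])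
    (by linarith only [iac, vac2]) (by linarith only [ibc, vbc1]) (by linarith only [ibc, vbc2])

end Summit.AtomisticToContinuum.Crystallization.Theorems.SquareWellLayerCakeGapTwelveToBarlow

end
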